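import Mathlib.Algebra.Order.Ring.Rat
import Mathlib.Data.Fin.VecNotation
import Mathlib.Tactic.NormNum
import HarnessLib

/-!
# Finite rational data of an approximate self-similar Navier–Stokes blow-up profile

Problem `NavierStokesRegularity`, route `CertifiedBlowup` (definition request
`Literature.NS.BlowupProfileData`). Computer-assisted blow-up proofs in the style of Chen–Hou
(*Stable nearly self-similar blowup of the 2D Boussinesq and 3D Euler equations with smooth data*,
arXiv:2210.07191; Part I analysis, Part II rigorous numerics; and the earlier arXiv:2107.06509)
certify a singularity from a **finite amount of rational data**: an approximate self-similar
profile computed numerically and stored as spline/Chebyshev coefficients on a truncated domain in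
similarity variables, the dynamic-rescaling exponents, a finite-rank description of the
unstable/neutral directions of the linearised operator, and finitely many rational constants
(residual size, coercivity constant of the weighted energy, constants in the nonlinear
estimates, truncation radius) that enter the bootstrap inequalities.

`Literature.NS.BlowupProfileData` packages exactly such data — **pure data, no `Prop` fields** — so that
route files can state "the inequalities certified for the datum `D` imply blow-up" with `D` an
explicit closed term (in principle checkable by `decide`/`norm_num`), separating the analytic
implication from the numerical verification.

## Fields (all rational / finite)

* `symmetry : SymmetryClass` — axisymmetric without swirl, or with swirl and a parity tag
  (odd/even in `z`) as in Hou's scenario;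
* `cl, cw : ℚ` — the dynamic-rescaling exponents `c_l` (space) and `c_ω` (amplitude);
* `numComponents, degR, degZ : ℕ` and
  `coeff : Fin numComponents → Fin degR → Fin degZ → ℚ` — tensor-product Chebyshev/spline
  coefficient array of the approximate profile components (velocity/vorticity/stream function in
  similarity variables `(R, Z)`) on the truncated domain `[0, domainRadius] × [0, domainHeight]`;
* `unstableRank : ℕ`, `unstableBasis : Fin unstableRank → (same index shape) → ℚ` — rational
  coefficients of a basis of the finite-dimensional unstable/neutral projection that is modulated
  out;
* `residualBound, coercivity : ℚ`, `nonlinearConsts : List ℚ`, `domainRadius, domainHeight : ℚ`.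

No well-formedness is imposed here (positivity of `ε, κ`, radius, consistency of degrees); those
are hypotheses of the route's certification statements. Mathlib has nothing specific to reuse
beyond `ℚ`, `Fin`, `List`.

## References

* J. Chen, T. Y. Hou, *Stable nearly self-similar blowup of the 2D Boussinesq and 3D Euler
  equations with smooth data I: Analysis; II: Rigorous numerics*, arXiv:2210.07191 (2022) — the
  data layout (approximate steady state + exponents + finite-rank unstable part + rational
  constants verified with interval arithmetic).
* J. Chen, T. Y. Hou, arXiv:2107.06509 (2021) (the `C^{1,α}` precursor).
-/

namespace Literature.NS

/-- Symmetry class of an axisymmetric blow-up scenario: no swirl (`u^θ ≡ 0`), or with swirl and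
the parity of the angular components in `z` (Hou's scenario is odd). Pure tag.
[cite: ChenHou2022, §1 (setting)] -/
inductive SymmetryClass
  /-- axisymmetric, no swirl -/
  | axisymNoSwirl
  /-- axisymmetric with swirl, angular velocity odd in `z` -/
  | axisymSwirlOdd
  /-- axisymmetric with swirl, angular velocity even in `z` -/
  | axisymSwirlEven
  deriving DecidableEq, Repr, Inhabited

/-- **Finite rational data of an approximate self-similar blow-up profile** (Chen–Hou-style
computer-assisted proof input): symmetry tag, dynamic-rescaling exponents `(c_l, c_ω)`, a
tensor-product coefficient array for the profile components on a truncated `(R, Z)`-domain, the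
finite-rank unstable/neutral basis, and the rational constants of the bootstrap. Pure data, no
`Prop` fields; well-formedness conditions are stated by consumers.
[cite: ChenHou2022, §1–2 (approximate profile, exponents, finite-rank part, rigorous constants)] -/
structure BlowupProfileData where
  /-- symmetry class of the scenario -/
  symmetry : SymmetryClass
  /-- dynamic-rescaling exponent `c_l` (spatial scaling rate) -/
  cl : ℚ
  /-- dynamic-rescaling exponent `c_ω` (amplitude/vorticity scaling rate) -/
  cw : ℚ
  /-- number of profile components stored (e.g. `u^θ/r`, `ω^θ/r`, `ψ/r`, …) -/
  numComponents : ℕ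
  /-- number of basis functions in the radial similarity variable `R` -/
  degR : ℕ
  /-- number of basis functions in the axial similarity variable `Z` -/
  degZ : ℕ
  /-- tensor-product (Chebyshev/spline) coefficients of the approximate profile:
  `coeff c i j` multiplies `φᵢ(R) ψⱼ(Z)` in component `c` -/
  coeff : Fin numComponents → Fin degR → Fin degZ → ℚ
  /-- truncation radius of the computational domain in `R` -/
  domainRadius : ℚ
  /-- truncation height of the computational domain in `Z` -/
  domainHeight : ℚ
  /-- rank of the unstable/neutral subspace of the linearised operator that is projected out -/
  unstableRank : ℕ
  /-- rational coefficients (same index shape as `coeff`) of a basis of that subspace -/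
  unstableBasis : Fin unstableRank → Fin numComponents → Fin degR → Fin degZ → ℚ
  /-- certified bound `ε` on the (weighted) residual of the approximate profile -/
  residualBound : ℚ
  /-- certified coercivity constant `κ` of the weighted linearised energy estimate -/
  coercivity : ℚ
  /-- the finitely many rational constants of the nonlinear and nonlocal estimates -/
  nonlinearConsts : List ℚ
  deriving Repr

namespace BlowupProfileData

/-- The total number of stored profile coefficients. [folklore] -/
def numCoeffs (D : BlowupProfileData) : ℕ :=
  D.numComponents * D.degR * D.degZ

/-- The zero coefficient array of a given shape (a placeholder profile), showing the structure is
inhabited for every shape; NOT a certified datum. [folklore] -/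
def zeroOfShape (s : SymmetryClass) (n r z : ℕ) : BlowupProfileData where
  symmetry := s
  cl := 0
  cw := 0
  numComponents := n
  degR := r
  degZ := z
  coeff := fun _ _ _ => 0
  domainRadius := 0
  domainHeight := 0
  unstableRank := 0
  unstableBasis := fun i => i.elim0
  residualBound := 0
  coercivity := 0
  nonlinearConsts := []

/-- Coefficient count of the placeholder profile. [folklore] -/
@[simp] theorem numCoeffs_zeroOfShape (s : SymmetryClass) (n r z : ℕ) :
    (zeroOfShape s n r z).numCoeffs = n * r * z := rfl

/-- The bootstrap constants are *well-formed* when residual bound, coercivity and truncation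
sizes are positive (the minimal sanity conditions consumers will assume; kept outside the
structure on purpose). [folklore] -/
def IsWellFormed (D : BlowupProfileData) : Prop :=
  0 < D.residualBound ∧ 0 < D.coercivity ∧ 0 < D.domainRadius ∧ 0 < D.domainHeight

/-- Well-formedness is decidable (rational comparisons); concrete data are checked by
`norm_num [IsWellFormed]` (kernel `decide` gets stuck on `Rat.blt` of literals). [folklore] -/
instance (D : BlowupProfileData) : Decidable D.IsWellFormed := by
  unfold IsWellFormed; infer_instance

/-- A toy datum (shape `1 × 2 × 2`, all constants `1`) that is well-formed (`example` below,
by `norm_num`); NOT a certified profile. [folklore] -/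
def toy : BlowupProfileData where
  symmetry := .axisymSwirlOdd
  cl := 3
  cw := -1
  numComponents := 1
  degR := 2
  degZ := 2
  coeff := fun _ i j => if i = j then 1 else 0
  domainRadius := 10
  domainHeight := 10
  unstableRank := 1
  unstableBasis := fun _ _ _ _ => 1
  residualBound := 1 / 1000
  coercivity := 1 / 10
  nonlinearConsts := [1, 2, 3]

example : toy.IsWellFormed := by norm_num [IsWellFormed, toy]

end BlowupProfileData

end Literature.NS
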